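import Mathlib
import Summits.Ventures.HodgeRepro.Tier4.Common.AdelicDefs
import Summits.Ventures.HodgeRepro.Tier4.Common.AdelicRTF
import Summits.Ventures.HodgeRepro.Tier4.Line1.RTFSetting
import Summits.Ventures.HodgeRepro.Tier4.Line1.RationalPoints
import Summits.Ventures.HodgeRepro.Tier4.Line1.CocompactReduction
import Summits.Ventures.HodgeRepro.Tier4.Line1.LocallyCompactGA
import Summits.Ventures.HodgeRepro.Tier4.Line1.SigmaCompactGA
import Summits.Ventures.HodgeRepro.Tier4.Line1.RightInvariantOfFundamentalDomain

/-!
# Tier4/Common/SettingOfData — a SORRY-FREE `RTF.Setting (GA W)` on the defined adelic objects from an `RTFData`, a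
Haar measure and DISPLAYED cocompactness data (the sorry-free twin of LINE L1's skeleton `Setting.ofAdelic`, whose
`DG` is `Classical.choose (quotient_compact …)`, a declared wall)

Blind re-derivation cell `pub-hodge-repro`, Tier 4 (README §9–§10), seat t4-typer-2 (gen 2).  Target tree path
`lean/Summits/Ventures/HodgeRepro/Tier4/Common/SettingOfData.lean`.  Imports `Common.AdelicDefs` (`GA`, `rationalPoints`,
`torusT`, `torusT'`, `centre`, `centre_le_*`), `Common.AdelicRTF` (`RTFData`), `Line1.RTFSetting` (`RTF.Setting`,
t4-plan-1 p662473), `Line1.RationalPoints` (`rationalPoints_discrete`, `rationalPoints_closed`, t4-L1-p5 p662344),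
`Line1.CocompactReduction` (`rationalPoints_countable`), `Line1.LocallyCompactGA` (`locallyCompact_GA`),
`Line1.SigmaCompactGA`, `Line1.RightInvariantOfFundamentalDomain` (`isMulRightInvariant_of_isFundamentalDomain`).

WHY (t4-plan-4 S13201 R2, typer-2 S13205).  The irreducibility the L4 wall's `V`-clause needs is L1's landed notion
on `RTF.Setting`: a relatively-closed invariant subspace with no proper relatively-closed invariant subspace
(`RTF.Setting.RelClosed`, `IsRCI`, `exists_minimal_rci` — IrreducibleSubspace.lean).  To consume it BY NAME on the
defined objects, a line needs an `RTF.Setting (GA W)`: **`Setting.ofAdelicData`** builds one from `R : RTFData W`, a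
Haar measure `μ` on `G(𝔸_k)`, and the DISPLAYED data «`DG` is a relatively compact fundamental domain of `G(k)` in
`G(𝔸_k)`» and «`R.DT`, `R.DT'` are relatively compact» — the cocompactness walls of the lines (Borel–Harish-Chandra /
Fujisaki), which no declaration here proves.  Every other field is a landed theorem: `G(k)` discrete and closed
(L1-p5), right-invariance of `μ` from the relatively compact fundamental domain (L1-p5), the centre's inclusions and
centrality (AdelicDefs).  `CocompactBridge.exists_rtfData_isHaar_closure` supplies the torus half of the data from the
named cocompactness `IsCocompactRational`.

Nothing here says anything about the status of the Hodge conjecture for CM abelian varieties, which is NOT proved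
(HC_CM is NOT proved by anyone in this repository).
-/

set_option autoImplicit false

noncomputable section

namespace Summit.Ventures.HodgeRepro.Tier4.Common

open MeasureTheory Line1

variable {k : Type} [Field k] [NumberField k] (W : PlaneData k)

/-- **The RTF setting of the defined objects from displayed cocompactness data** (sorry-free): `Gk := G(k)`,
`T`, `T′`, `Z := centre W`, the Haar measure `μ` on `G(𝔸_k)` with the displayed relatively compact fundamental domain
`DG`, the torus data of `R`. -/
def Setting.ofAdelicData [MeasurableSpace (GA W)] [BorelSpace (GA W)] (R : RTFData W) (μ : Measure (GA W))
    [μ.IsHaarMeasure] [R.μT.IsHaarMeasure] [R.μT'.IsHaarMeasure] (DG : Set (GA W))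
    (fdG : IsFundamentalDomain (rationalPoints W) DG μ) (compG : IsCompact (closure DG))
    (compT : IsCompact (closure R.DT)) (compT' : IsCompact (closure R.DT')) : RTF.Setting (GA W) where
  Gk := rationalPoints W
  T := torusT W
  T' := torusT' W
  Z := centre W
  μ := μ
  μT := R.μT
  μT' := R.μT'
  DG := DG
  DT := R.DT
  DT' := R.DT'
  haar := inferInstance
  rightInv := by
    haveI := locallyCompact_GA W
    haveI := sigmaCompact_GA W
    haveI := rationalPoints_countable W
    exact isMulRightInvariant_of_isFundamentalDomain μ (rationalPoints W) fdG compG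
  haarT := inferInstance
  haarT' := inferInstance
  fdG := fdG
  fdT := R.DT_fund
  fdT' := R.DT'_fund
  compG := compG
  compT := compT
  compT' := compT'
  discrete := rationalPoints_discrete W
  closed := rationalPoints_closed W
  ZleT := centre_le_torusT W
  ZleT' := centre_le_torusT' W
  central := fun z hz g => (Subgroup.mem_center_iff.1 (centre_le_center W hz) g).symm

/-- The groups of the setting are the defined ones. -/
theorem Setting.ofAdelicData_Gk [MeasurableSpace (GA W)] [BorelSpace (GA W)] (R : RTFData W) (μ : Measure (GA W))
    [μ.IsHaarMeasure] [R.μT.IsHaarMeasure] [R.μT'.IsHaarMeasure] (DG : Set (GA W))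
    (fdG : IsFundamentalDomain (rationalPoints W) DG μ) (compG : IsCompact (closure DG))
    (compT : IsCompact (closure R.DT)) (compT' : IsCompact (closure R.DT')) :
    (Setting.ofAdelicData W R μ DG fdG compG compT compT').Gk = rationalPoints W := rfl

/-- The torus data of the setting are those of `R`. -/
theorem Setting.ofAdelicData_DT [MeasurableSpace (GA W)] [BorelSpace (GA W)] (R : RTFData W) (μ : Measure (GA W))
    [μ.IsHaarMeasure] [R.μT.IsHaarMeasure] [R.μT'.IsHaarMeasure] (DG : Set (GA W))
    (fdG : IsFundamentalDomain (rationalPoints W) DG μ) (compG : IsCompact (closure DG))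
    (compT : IsCompact (closure R.DT)) (compT' : IsCompact (closure R.DT')) :
    (Setting.ofAdelicData W R μ DG fdG compG compT compT').DT = R.DT := rfl

end Summit.Ventures.HodgeRepro.Tier4.Common

end
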